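import Summits.QuantumFields.YangMills.Theorems.BalabanUVNodesN22KernelLimitOfNestedTermsModel

/-!
# THE NESTED-TERMS MODEL, II — the SOFT instance (exact (S) FAILS at every volume; the soft schema fires) and the COUPLING-READING packaging as a `TermFamily1`:
# W1-19b's `GeometricIncrements` with a NECESSARILY NON-ZERO constant, `PolLimitsExist`, the windowed NE9 bound, and dag-n22-w3 g2's
# `ne9_EA_of_increments_of_windowed` ∕ `n22At_u3OfRecord₁₃_objects_of_increments_of_windowed` (p595960) FIRING WITH NON-ZERO VOLUME INCREMENTS

Cell `pub-ymgap`, Track A (HUMAN RULING D-0062), WIDTH SEAT `dag-n22-w3` g5 on node n22 = NE9, A6-residue lane; `--kind proof --supports stmt-QuantumFields-27366 --as helper`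
(KEY MAP v2), COUNT-NEUTRAL.  THEOREMS ONLY (0 `def`, 0 `sorry`, standard axioms).  Sequel of `…N22KernelLimitOfNestedTermsModel` (this seat, g5 FILE 1): there the nested-terms
model — on the `K`-th torus the `K + 1` on-site terms `W ↦ a K i · W 0 (siteOfInt F K j 0)`, `i ≤ K` — fires BOTH (1.21)-existence schemas of the lineage and, at `a K i := r^i`, has
windowed kernels STRICTLY INCREASING in the volume with limit `(1 − r)⁻¹` attained at no finite volume.

* §1 THE SOFT INSTANCE `a K i := r^i · (1 − s^{K+1})` (`0 ≤ r, s < 1`; the terms read the volume weakly, as the (2.13) terms do through the minimizer of [I] p. 264):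
  ★★ `polLimitExists_nested_soft` (FILE 1's `polLimitExists_nested_of_approxBlind`, i.e. p606602's SOFT SCHEMA, FIRES: (S≈) with `C₀ = (1 − r)⁻¹` at ratio `s`, (T) with `C₁ = r`);
  ★ `not_stable_nested_soft` — for `0 < r`, `0 < s` EXACT (S) FAILS AT EVERY VOLUME at the origin entry (the small-class partial sums of def-B's scalar kernels in volumes `K + 1`, `K`
  differ by `(Σ_{i ≤ K} r^i) · s^{K+1}(1 − s) > 0`): p597055's hard schema is NOT available for this family, p606602's (S≈) edition is GENUINELY needed — the located reason the
  soft road exists; `tendsto_polWindow_nested_soft` (the SAME (1.21) limit `(1 − r)⁻¹`: the volume-reading factor is invisible in the limit).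
* §2 THE COUPLING-READING NESTED FAMILY `ℰ k v K : W ↦ Σ_{i ≤ K} fadingAmp ω k v · r^i · W 0 (siteOfInt F K (k+1) 0)` (dag-n18-w2's fading amplitude `Σ_{i ≤ k} ω^{k+1−i} v_i` as the
  history factor — their `fadingTermFamily` is the volume-blind case «one term»): `polWindow_nestedFading` (= `(Σ_{i ≤ K} r^i) ×` dag-n18-w2's windowed kernel), ★★
  `geometricIncrements_nestedFading` (W1-19b's INCREMENTS LETTER at ratio `r` with the constant `r·|γ|ω∕(1 − ω)`) and ★ `increment_nestedFading_origin_pos` (the increment at the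
  origin entry is `r^{K+1} · fadingAmp > 0` at EVERY volume — the letter holds at NO constant `0`, unlike `geometricIncrements_fading` ∕ `…_cross`), ★★ `polLimitsExist_nestedFading`
  (W1-19b's EXISTENCE LETTER through dag-n22-w3 g2's `polLimitExists_histories_of_geometric_increments` — with non-zero increments), `windowedNE9_nestedFading` (the windowed joint
  history-Lipschitz bound with moduli `(1 − r)⁻¹ ω^{k+1−i}`: dag-n18-w2's `windowedNE9_fading` × `Σ_{i ≤ K} r^i ≤ (1 − r)⁻¹`).
* §3 ★★★ `ne9_EA_nestedFading` — dag-n22-w3 g2's `ne9_EA_of_increments_of_windowed` (p595960 §2: NE9 of W1-19's kernel functional from geometric volume-increments + windowed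
  bounds, BOTH finite-volume inputs) FIRES WITH NON-ZERO INCREMENTS; ★★★ `n22At_nestedFading` — `N22At (u3OfRecord₁₃ θ (objects F ℰ id 𝟙 ⟨κ, ω, 0, (1 − r)⁻¹, ω, 0, ω⟩) k)` for EVERY
  Stage-13 tuple `θ` and run length `k` through g2's `n22At_u3OfRecord₁₃_objects_of_increments_of_windowed`; `kernelA_nestedFading` (W1-19's LIMITING kernel in closed form
  `[μ = ν = 0][z = 0] · fadingAmp ω k (g_0, …, g_k) · (1 − r)⁻¹` — non-zero, reading every coupling, and attained by NO windowed kernel: `kernelA_nestedFading_ne_polWindow`).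

HONEST FRAMING (binding).  MODEL LEVEL (scalar algebra, `ρ = id`, one colour; test functionals): NOT Bałaban's (2.13) terms, NOT def-W1's `localizedSum` of a tower of record;
inhabits NO letter OF RECORD (`…OfRecord₁₃` read `θ`'s own term data); nothing of Bałaban's asserted or constructed; (1.21)'s existence and NE9 for the terms OF RECORD NOT proved;
N22 NOT discharged; K3⁸ `SpineGivenEndpointR13SepCoPHV` OPEN, not claimed, no stub touched; counts UNMOVED (typed 28∕28 · discharged 5∕27; the chair's single count line is the only
count); one finite 𝕋⁴ programme at fixed ε — R4 closes the CONDITIONAL rung `BalabanLadder.UV` only; NOTHING about the continuum limit, ℝ⁴, OS axioms or a mass gap is proved or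
claimed; the Yang–Mills mass gap (Clay) is NOT proved by any of this.  No cite tags (Summit side); TYPES only: [I] = [Balaban1987RG1] CMP **109** (1987) (1.18) p. 263, (1.20)–(1.21)
p. 264.
-/

noncomputable section

open Filter Topology
open scoped BigOperators

namespace YMDAG.N22.AtKernels.NestedTermsModel

open Literature.MathematicalPhysics.QuantumFieldTheory.Balaban1983to89
open Literature.MathematicalPhysics.QuantumFieldTheory.Balaban1983to89.T4Continuum (T4Family)
open Literature.MathematicalPhysics.QuantumFieldTheory.Balaban1983to89.T4OutputRate (Window NE9)
open Literature.MathematicalPhysics.QuantumFieldTheory.Balaban1983to89.Node00 (siteOfInt polScalar polWindow polLimit PolLimitExists TermFamily1 Stage13Params U3Letters₁₁)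
open Literature.MathematicalPhysics.QuantumFieldTheory.Balaban1983to89.Node00.U3OfKernels (histPrefix kernelA EA objects)
open Literature.MathematicalPhysics.QuantumFieldTheory.Balaban1983to89.Node00.U3KernelLetters (PolLimitsExist GeometricIncrements)
open Literature.MathematicalPhysics.QuantumFieldTheory.Balaban1983to89.B12Sec2to5 (l1)
open YMDAG.UVSplit (N22At u3OfRecord₁₃)
open YMDAG.N22.AtKernels (ne9_EA_of_increments_of_windowed n22At_u3OfRecord₁₃_objects_of_increments_of_windowed)
open YMDAG.N18.PolLimitRate (polLimitsExist_of_geometricIncrements)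
open YMDAG.N18.FiniteVolumeLettersModel (fadingAmp fadingTermFamily polWindow_fadingTermFamily polWindow_fadingTermFamily_eventually abs_fadingAmp_le fadingAmp_pos
  histPrefix_mem_box windowedNE9_fading fadingLetters fadingLetters_moduli)

variable (F : T4Family)

/-! ## §5 THE SOFT INSTANCE `a K i := r^i · (1 − s^{K+1})`: the soft schema fires, and exact (S) FAILS at every volume -/

section SoftInstance

variable {r s : ℝ}

/-- The small classes' total amplitude moves by EXACTLY `(Σ_{i ≤ K} r^i) · s^{K+1} (1 − s)` between consecutive volumes. -/
theorem sum_soft_sub (K : ℕ) :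
    ∑ i ∈ Finset.range (K + 1), (r ^ i * (1 - s ^ (K + 1 + 1)) - r ^ i * (1 - s ^ (K + 1))) = (∑ i ∈ Finset.range (K + 1), r ^ i) * (s ^ (K + 1) * (1 - s)) := by
  rw [Finset.sum_mul]
  exact Finset.sum_congr rfl fun i _ => by ring

/-- ★★ **(1.21) EXISTS FOR THE SOFT NESTED-TERMS FAMILY** `W ↦ Σ_{i ≤ K} r^i (1 − s^{K+1}) · W 0 (siteOfInt F K j 0)` (`0 ≤ r < 1`, `0 ≤ s < 1`), BY THE SOFT SCHEMA: (S≈) with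
`C₀ = (1 − r)⁻¹`, ratio `s` (`Σ_{i ≤ K} r^i ≤ (1 − r)⁻¹`, `s^{K+1}(1 − s) ≤ s^K`); (T) with `C₁ = r`, ratio `r`. -/
theorem polLimitExists_nested_soft (j : ℕ) (hr : r < 1) (hr₀ : 0 ≤ r) (hs : s < 1) (hs₀ : 0 ≤ s) :
    PolLimitExists F j (fun K (W : Fin (F.P K).d → Site (F.P K) j → ℝ) =>
        ∑ i ∈ Finset.range (K + 1), r ^ i * (1 - s ^ (K + 1)) * W (Fin.cast (F.P_d K).symm 0) (siteOfInt F K j 0)) (ContinuousLinearMap.id ℝ ℝ)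
      (Module.Basis.singleton Unit ℝ) := by
  refine polLimitExists_nested_of_approxBlind F (fun K i => r ^ i * (1 - s ^ (K + 1))) j (C₀ := (1 - r)⁻¹) (C₁ := r) hr hr₀ hs hs₀ (fun K => ?_) (fun K => ?_)
  · have hs1 : 0 ≤ s ^ (K + 1) * (1 - s) := mul_nonneg (pow_nonneg hs₀ _) (sub_nonneg.2 hs.le)
    rw [sum_soft_sub, abs_of_nonneg (mul_nonneg (Finset.sum_nonneg fun i _ => pow_nonneg hr₀ i) hs1)]
    refine mul_le_mul (sum_le_hasSum _ (fun i _ => pow_nonneg hr₀ i) (hasSum_geometric_of_lt_one hr₀ hr)) ?_ hs1 (inv_nonneg.2 (sub_nonneg.2 hr.le))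
    calc s ^ (K + 1) * (1 - s) = s ^ K * (s * (1 - s)) := by ring
      _ ≤ s ^ K * 1 := mul_le_mul_of_nonneg_left (mul_le_one₀ hs.le (sub_nonneg.2 hs.le) (sub_le_self 1 hs₀)) (pow_nonneg hs₀ K)
      _ = s ^ K := mul_one _
  · rw [abs_of_nonneg (mul_nonneg (pow_nonneg hr₀ _) (sub_nonneg.2 (pow_le_one₀ hs₀ hs.le)))]
    calc r ^ (K + 1) * (1 - s ^ (K + 1 + 1)) ≤ r ^ (K + 1) * 1 := mul_le_mul_of_nonneg_left (sub_le_self _ (pow_nonneg hs₀ _)) (pow_nonneg hr₀ _)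
      _ = r * r ^ K := by rw [mul_one, pow_succ, mul_comm]

/-- ★ **EXACT (S) FAILS AT EVERY VOLUME FOR THE SOFT FAMILY** (`0 < r`, `0 < s < 1`) at the origin entry: the small-class partial sums of def-B's scalar kernels in the volumes
`K + 1` and `K` differ by `(Σ_{i ≤ K} r^i) · s^{K+1} (1 − s) > 0` — so the hard schema's (S) clause is NOT available for this family and p606602's (S≈) edition is genuinely
needed (the located reason the soft road exists). -/
theorem not_stable_nested_soft (K j : ℕ) (hr₀ : 0 < r) (hs : s < 1) (hs₀ : 0 < s) :
    0 < ∑ i ∈ (Finset.range (K + 2)).filter (fun i => i ≤ K),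
          polScalar (fun W : Fin (F.P (K + 1)).d → Site (F.P (K + 1)) j → ℝ => r ^ i * (1 - s ^ (K + 1 + 1)) * W (Fin.cast (F.P_d (K + 1)).symm 0) (siteOfInt F (K + 1) j 0))
            (ContinuousLinearMap.id ℝ ℝ) (Module.Basis.singleton Unit ℝ) (Fin.cast (F.P_d (K + 1)).symm 0) (siteOfInt F (K + 1) j 0) (Fin.cast (F.P_d (K + 1)).symm 0)
            (siteOfInt F (K + 1) j 0) -
        ∑ i ∈ (Finset.range (K + 1)).filter (fun i => i ≤ K),
          polScalar (fun W : Fin (F.P K).d → Site (F.P K) j → ℝ => r ^ i * (1 - s ^ (K + 1)) * W (Fin.cast (F.P_d K).symm 0) (siteOfInt F K j 0))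
            (ContinuousLinearMap.id ℝ ℝ) (Module.Basis.singleton Unit ℝ) (Fin.cast (F.P_d K).symm 0) (siteOfInt F K j 0) (Fin.cast (F.P_d K).symm 0) (siteOfInt F K j 0) := by
  have e1 := fun i => polScalar_onSite F (K + 1) j (r ^ i * (1 - s ^ (K + 1 + 1))) 0 0 0
  have e0 := fun i => polScalar_onSite F K j (r ^ i * (1 - s ^ (K + 1))) 0 0 0
  simp only [true_and, if_true] at e1 e0
  simp only [e1, e0, filter_range_le, filter_range_succ_le, ← Finset.sum_sub_distrib, sum_soft_sub]
  refine mul_pos (Finset.sum_pos (fun i _ => pow_pos hr₀ i) ⟨0, by simp⟩) (mul_pos (pow_pos hs₀ _) (sub_pos.2 hs))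

/-- **THE SAME (1.21) LIMIT `(1 − r)⁻¹` AT THE ORIGIN ENTRY**: the volume-reading factor `1 − s^{K+1} → 1` is invisible in the limit (`0 ≤ r < 1`, `0 ≤ s < 1`). -/
theorem tendsto_polWindow_nested_soft (j : ℕ) (hr : r < 1) (hr₀ : 0 ≤ r) (hs : s < 1) (hs₀ : 0 ≤ s) :
    Tendsto (fun K : ℕ => polWindow F K j (fun W : Fin (F.P K).d → Site (F.P K) j → ℝ =>
        ∑ i ∈ Finset.range (K + 1), r ^ i * (1 - s ^ (K + 1)) * W (Fin.cast (F.P_d K).symm 0) (siteOfInt F K j 0)) (ContinuousLinearMap.id ℝ ℝ)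
        (Module.Basis.singleton Unit ℝ) 0 0 0) atTop (𝓝 (1 - r)⁻¹) := by
  have e : ∀ K : ℕ, polWindow F K j (fun W : Fin (F.P K).d → Site (F.P K) j → ℝ =>
        ∑ i ∈ Finset.range (K + 1), r ^ i * (1 - s ^ (K + 1)) * W (Fin.cast (F.P_d K).symm 0) (siteOfInt F K j 0)) (ContinuousLinearMap.id ℝ ℝ)
        (Module.Basis.singleton Unit ℝ) 0 0 0 = (∑ i ∈ Finset.range (K + 1), r ^ i) * (1 - s ^ (K + 1)) := fun K => by
    rw [polWindow_nested_origin F (fun K i => r ^ i * (1 - s ^ (K + 1))) K j, Finset.sum_mul]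
  simp only [e]
  have h1 : Tendsto (fun K : ℕ => ∑ i ∈ Finset.range (K + 1), r ^ i) atTop (𝓝 (1 - r)⁻¹) :=
    ((hasSum_geometric_of_lt_one hr₀ hr).tendsto_sum_nat).comp (tendsto_add_atTop_nat 1)
  have h2 : Tendsto (fun K : ℕ => 1 - s ^ (K + 1)) atTop (𝓝 (1 - 0)) :=
    tendsto_const_nhds.sub ((tendsto_pow_atTop_nhds_zero_of_lt_one hs₀ hs).comp (tendsto_add_atTop_nat 1))
  simpa using h1.mul h2

end SoftInstance

/-! ## §2 The coupling-reading nested family as a `TermFamily1`: W1-19b's letters with NON-ZERO increments -/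

section Letters

variable {ω r : ℝ}

/-- **THE WINDOWED KERNEL OF THE COUPLING-READING NESTED FAMILY** `W ↦ Σ_{i ≤ K} fadingAmp ω k v · r^i · W 0 (siteOfInt F K (k+1) 0)` is `(Σ_{i ≤ K} r^i)` times dag-n18-w2's
windowed kernel of `fadingTermFamily F ω` (FILE 1's `polWindow_nested` and their `polWindow_fadingTermFamily`, both closed forms). -/
theorem polWindow_nestedFading (k : ℕ) (v : Fin (k + 1) → ℝ) (K : ℕ) (μ ν : Fin 4) (z : Fin 4 → ℤ) :
    polWindow F K (k + 1) (fun W : Fin (F.P K).d → Site (F.P K) (k + 1) → ℝ =>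
        ∑ i ∈ Finset.range (K + 1), fadingAmp ω k v * r ^ i * W (Fin.cast (F.P_d K).symm 0) (siteOfInt F K (k + 1) 0)) (ContinuousLinearMap.id ℝ ℝ)
        (Module.Basis.singleton Unit ℝ) μ ν z =
      (∑ i ∈ Finset.range (K + 1), r ^ i) *
        polWindow F K (k + 1) (fadingTermFamily F ω k v K) (ContinuousLinearMap.id ℝ ℝ) (Module.Basis.singleton Unit ℝ) μ ν z := by
  have e := polWindow_nested F (fun _ i => fadingAmp ω k v * r ^ i) K (k + 1) μ ν z
  beta_reduce at e
  rw [e, polWindow_fadingTermFamily, ← Finset.mul_sum]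
  split_ifs <;> ring

/-- ★★ **W1-19b's INCREMENTS LETTER AT RATIO `r` WITH THE CONSTANT `r · |γ| ω ∕ (1 − ω)`** (`0 ≤ ω < 1`, `0 ≤ r`): from the window-separation threshold on, dag-n18-w2's kernel is the
constant `[μ = ν = 0][z = 0] · fadingAmp`, so consecutive volumes differ by EXACTLY `r^{K+1} · [⋯] · fadingAmp`, and `|fadingAmp| ≤ |γ| ω ∕ (1 − ω)` on the window (`abs_fadingAmp_le`). -/
theorem geometricIncrements_nestedFading (hω : 0 ≤ ω) (hω1 : ω < 1) (hr₀ : 0 ≤ r) (γ : ℝ) :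
    GeometricIncrements F (fun k v K (W : Fin (F.P K).d → Site (F.P K) (k + 1) → ℝ) =>
        ∑ i ∈ Finset.range (K + 1), fadingAmp ω k v * r ^ i * W (Fin.cast (F.P_d K).symm 0) (siteOfInt F K (k + 1) 0)) (ContinuousLinearMap.id ℝ ℝ)
      (Module.Basis.singleton Unit ℝ) (Window γ) r := by
  intro g hg k μ ν z
  obtain ⟨K₀, hK₀⟩ := eventually_atTop.1 (polWindow_fadingTermFamily_eventually F ω k (histPrefix g k) μ ν z)
  refine ⟨K₀, r * (|γ| * (ω / (1 - ω))), fun K hK => ?_⟩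
  rw [polWindow_nestedFading, polWindow_nestedFading, hK₀ (K + 1) (le_trans hK (Nat.le_succ K)), hK₀ K hK, ← sub_mul, Finset.sum_range_succ, add_sub_cancel_left,
    abs_mul, abs_of_nonneg (pow_nonneg hr₀ _), show r * (|γ| * (ω / (1 - ω))) * r ^ K = r ^ (K + 1) * (|γ| * (ω / (1 - ω))) by ring]
  refine mul_le_mul_of_nonneg_left ?_ (pow_nonneg hr₀ _)
  split_ifs
  · exact abs_fadingAmp_le hω hω1 (histPrefix_mem_box hg k)
  · rw [abs_zero]; exact mul_nonneg (abs_nonneg γ) (div_nonneg hω (sub_nonneg.2 hω1.le))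

/-- ★ **… AND AT NO CONSTANT `0`: THE INCREMENT AT THE ORIGIN ENTRY IS `r^{K+1} · fadingAmp ω k (g_0, …, g_k) > 0` AT EVERY VOLUME** (`0 < ω`, `0 < r`, `g` in the window) — unlike
dag-n18-w2's `geometricIncrements_fading` ∕ `geometricIncrements_cross`, whose increments vanish eventually. -/
theorem increment_nestedFading_origin_pos (hω : 0 < ω) (hr₀ : 0 < r) {γ : ℝ} {g : ℕ → ℝ} (hg : g ∈ Window γ) (k K : ℕ) :
    0 < polWindow F (K + 1) (k + 1) (fun W : Fin (F.P (K + 1)).d → Site (F.P (K + 1)) (k + 1) → ℝ =>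
          ∑ i ∈ Finset.range (K + 1 + 1), fadingAmp ω k (histPrefix g k) * r ^ i * W (Fin.cast (F.P_d (K + 1)).symm 0) (siteOfInt F (K + 1) (k + 1) 0))
          (ContinuousLinearMap.id ℝ ℝ) (Module.Basis.singleton Unit ℝ) 0 0 0 -
        polWindow F K (k + 1) (fun W : Fin (F.P K).d → Site (F.P K) (k + 1) → ℝ =>
          ∑ i ∈ Finset.range (K + 1), fadingAmp ω k (histPrefix g k) * r ^ i * W (Fin.cast (F.P_d K).symm 0) (siteOfInt F K (k + 1) 0))
          (ContinuousLinearMap.id ℝ ℝ) (Module.Basis.singleton Unit ℝ) 0 0 0 := by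
  rw [polWindow_nestedFading, polWindow_nestedFading, polWindow_fadingTermFamily, polWindow_fadingTermFamily]
  simp only [true_and, if_true]
  rw [← sub_mul, Finset.sum_range_succ, add_sub_cancel_left]
  exact mul_pos (pow_pos hr₀ _) (fadingAmp_pos hω (histPrefix_mem_box hg k))

/-- ★★ **W1-19b's EXISTENCE LETTER `PolLimitsExist` FOR THE COUPLING-READING NESTED FAMILY** (`0 ≤ ω < 1`, `0 ≤ r < 1`) through dag-n18-w2's
`polLimitsExist_of_geometricIncrements` (= dag-n22-w3 g2's `polLimitExists_histories_of_geometric_increments`, p595960, at the letter names) — the Cauchy road, here with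
non-zero increments. -/
theorem polLimitsExist_nestedFading (hω : 0 ≤ ω) (hω1 : ω < 1) (hr : r < 1) (hr₀ : 0 ≤ r) (γ : ℝ) :
    PolLimitsExist F (fun k v K (W : Fin (F.P K).d → Site (F.P K) (k + 1) → ℝ) =>
        ∑ i ∈ Finset.range (K + 1), fadingAmp ω k v * r ^ i * W (Fin.cast (F.P_d K).symm 0) (siteOfInt F K (k + 1) 0)) (ContinuousLinearMap.id ℝ ℝ)
      (Module.Basis.singleton Unit ℝ) (Window γ) :=
  polLimitsExist_of_geometricIncrements F
    (fun k v K (W : Fin (F.P K).d → Site (F.P K) (k + 1) → ℝ) =>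
      ∑ i ∈ Finset.range (K + 1), fadingAmp ω k v * r ^ i * W (Fin.cast (F.P_d K).symm 0) (siteOfInt F K (k + 1) 0))
    (ContinuousLinearMap.id ℝ ℝ) (Module.Basis.singleton Unit ℝ) hr (geometricIncrements_nestedFading F hω hω1 hr₀ γ)

/-- **THE WINDOWED JOINT HISTORY-LIPSCHITZ BOUND WITH MODULI `(1 − r)⁻¹ ω^{k+1−i}`** (eventually in the volume; `0 ≤ ω`, `0 ≤ r < 1`): dag-n18-w2's `windowedNE9_fading` bound
times `Σ_{i ≤ K} r^i ≤ (1 − r)⁻¹`.  The `hK` input of dag-n22-w3 g2's `ne9_EA_of_increments_of_windowed`. -/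
theorem windowedNE9_nestedFading (hω : 0 ≤ ω) (hr : r < 1) (hr₀ : 0 ≤ r) (γ κ : ℝ) :
    ∀ g ∈ Window γ, ∀ g' ∈ Window γ, ∀ (k : ℕ) (μ ν : Fin 4) (z : Fin 4 → ℤ), ∀ᶠ K in atTop,
      |polWindow F K (k + 1) (fun W : Fin (F.P K).d → Site (F.P K) (k + 1) → ℝ =>
            ∑ i ∈ Finset.range (K + 1), fadingAmp ω k (histPrefix g k) * r ^ i * W (Fin.cast (F.P_d K).symm 0) (siteOfInt F K (k + 1) 0))
            (ContinuousLinearMap.id ℝ ℝ) (Module.Basis.singleton Unit ℝ) μ ν z -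
          polWindow F K (k + 1) (fun W : Fin (F.P K).d → Site (F.P K) (k + 1) → ℝ =>
            ∑ i ∈ Finset.range (K + 1), fadingAmp ω k (histPrefix g' k) * r ^ i * W (Fin.cast (F.P_d K).symm 0) (siteOfInt F K (k + 1) 0))
            (ContinuousLinearMap.id ℝ ℝ) (Module.Basis.singleton Unit ℝ) μ ν z| ≤
        Real.exp (-(κ * l1 z)) * ∑ i ∈ Finset.range (k + 1), (1 - r)⁻¹ * ω ^ (k + 1 - i) * |g i - g' i| := by
  intro g hg g' hg' k μ ν z
  filter_upwards [windowedNE9_fading F hω γ κ g hg g' hg' k μ ν z] with K hK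
  have hS₀ : 0 ≤ ∑ i ∈ Finset.range (K + 1), r ^ i := Finset.sum_nonneg fun i _ => pow_nonneg hr₀ i
  have hS₁ : ∑ i ∈ Finset.range (K + 1), r ^ i ≤ (1 - r)⁻¹ := sum_le_hasSum _ (fun i _ => pow_nonneg hr₀ i) (hasSum_geometric_of_lt_one hr₀ hr)
  have hB : 0 ≤ Real.exp (-(κ * l1 z)) * ∑ i ∈ Finset.range (k + 1), (fadingLetters γ ω).moduli (k + 1) i * |g i - g' i| :=
    mul_nonneg (Real.exp_nonneg _) (Finset.sum_nonneg fun i _ => mul_nonneg (by rw [fadingLetters_moduli]; exact pow_nonneg hω _) (abs_nonneg _))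
  rw [polWindow_nestedFading, polWindow_nestedFading, ← mul_sub, abs_mul, abs_of_nonneg hS₀]
  calc (∑ i ∈ Finset.range (K + 1), r ^ i) * |polWindow F K (k + 1) (fadingTermFamily F ω k (histPrefix g k) K) (ContinuousLinearMap.id ℝ ℝ)
            (Module.Basis.singleton Unit ℝ) μ ν z -
          polWindow F K (k + 1) (fadingTermFamily F ω k (histPrefix g' k) K) (ContinuousLinearMap.id ℝ ℝ) (Module.Basis.singleton Unit ℝ) μ ν z|
      ≤ (1 - r)⁻¹ * (Real.exp (-(κ * l1 z)) * ∑ i ∈ Finset.range (k + 1), (fadingLetters γ ω).moduli (k + 1) i * |g i - g' i|) :=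
        mul_le_mul hS₁ hK (abs_nonneg _) (inv_nonneg.2 (sub_nonneg.2 hr.le))
    _ = Real.exp (-(κ * l1 z)) * ∑ i ∈ Finset.range (k + 1), (1 - r)⁻¹ * ω ^ (k + 1 - i) * |g i - g' i| := by
        rw [Finset.mul_sum, Finset.mul_sum, Finset.mul_sum]
        exact Finset.sum_congr rfl fun i _ => by rw [fadingLetters_moduli]; ring

end Letters

/-! ## §3 dag-n22-w3 g2's `…_of_increments_of_windowed` FIRE with non-zero increments: NE9 and `N22At` at the kernel objects; the limiting kernel in closed form -/

section Nodes

variable {ω r : ℝ} {N : ℕ} [NeZero N]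

/-- ★★★ **NE9 OF W1-19's KERNEL FUNCTIONAL FOR THE COUPLING-READING NESTED FAMILY, BY dag-n22-w3 g2's `ne9_EA_of_increments_of_windowed`** (p595960 §2) — geometric
volume-increments (NON-ZERO here) + the windowed joint history-Lipschitz bounds ⇒ `NE9 (EA F ℰ id 𝟙) (Window γ) κ ((1 − r)⁻¹ ω^{n−i})` (`0 ≤ ω < 1`, `0 ≤ r < 1`, every `κ`). -/
theorem ne9_EA_nestedFading (hω : 0 ≤ ω) (hω1 : ω < 1) (hr : r < 1) (hr₀ : 0 ≤ r) (γ κ : ℝ) :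
    NE9 (EA F (fun k v K (W : Fin (F.P K).d → Site (F.P K) (k + 1) → ℝ) =>
        ∑ i ∈ Finset.range (K + 1), fadingAmp ω k v * r ^ i * W (Fin.cast (F.P_d K).symm 0) (siteOfInt F K (k + 1) 0)) (ContinuousLinearMap.id ℝ ℝ)
        (Module.Basis.singleton Unit ℝ)) (Window γ) κ (fun n i => (1 - r)⁻¹ * ω ^ (n - i)) :=
  ne9_EA_of_increments_of_windowed F
    (fun k v K (W : Fin (F.P K).d → Site (F.P K) (k + 1) → ℝ) =>
      ∑ i ∈ Finset.range (K + 1), fadingAmp ω k v * r ^ i * W (Fin.cast (F.P_d K).symm 0) (siteOfInt F K (k + 1) 0))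
    (ContinuousLinearMap.id ℝ ℝ) (Module.Basis.singleton Unit ℝ) hr (geometricIncrements_nestedFading F hω hω1 hr₀ γ) (windowedNE9_nestedFading F hω hr hr₀ γ κ)

/-- The model's letter block `⟨κ, ω, 0, (1 − r)⁻¹, ω, 0, ω⟩` passes the displayed signs (`0 ≤ κ`, `0 < ω < 1`, `r < 1`). -/
theorem nestedFadingLetters_signs {κ : ℝ} (hκ : 0 ≤ κ) (hω : 0 < ω) (hω1 : ω < 1) (hr : r < 1) :
    (⟨κ, ω, 0, (1 - r)⁻¹, ω, 0, ω⟩ : U3Letters₁₁).Signs :=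
  ⟨hκ, hω, hω1, le_rfl, inv_nonneg.2 (sub_nonneg.2 hr.le), hω.le, hω1, le_rfl, le_rfl, le_rfl, hω1⟩

/-- ★★★ **`N22At` AT THE KERNEL OBJECTS OF THE COUPLING-READING NESTED FAMILY, BY dag-n22-w3 g2's `n22At_u3OfRecord₁₃_objects_of_increments_of_windowed`** (p595960 §2), for EVERY
Stage-13 tuple `θ` and run length `k`, with the letter block `⟨κ, ω, 0, (1 − r)⁻¹, ω, 0, ω⟩` (`0 ≤ κ`, `0 < ω < 1`, `0 ≤ r < 1`) — the N22 slot met through the Cauchy road with kernels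
whose (1.21) limits are attained at NO finite volume.  MODEL LEVEL; no object of record. -/
theorem n22At_nestedFading {κ : ℝ} (hκ : 0 ≤ κ) (hω : 0 < ω) (hω1 : ω < 1) (hr : r < 1) (hr₀ : 0 ≤ r) (θ : Stage13Params F N) (k : ℕ) :
    N22At (u3OfRecord₁₃ θ (objects F (fun k v K (W : Fin (F.P K).d → Site (F.P K) (k + 1) → ℝ) =>
        ∑ i ∈ Finset.range (K + 1), fadingAmp ω k v * r ^ i * W (Fin.cast (F.P_d K).symm 0) (siteOfInt F K (k + 1) 0)) (ContinuousLinearMap.id ℝ ℝ)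
        (Module.Basis.singleton Unit ℝ) ⟨κ, ω, 0, (1 - r)⁻¹, ω, 0, ω⟩) k) :=
  n22At_u3OfRecord₁₃_objects_of_increments_of_windowed F
    (fun k v K (W : Fin (F.P K).d → Site (F.P K) (k + 1) → ℝ) =>
      ∑ i ∈ Finset.range (K + 1), fadingAmp ω k v * r ^ i * W (Fin.cast (F.P_d K).symm 0) (siteOfInt F K (k + 1) 0))
    (ContinuousLinearMap.id ℝ ℝ) (Module.Basis.singleton Unit ℝ) θ ⟨κ, ω, 0, (1 - r)⁻¹, ω, 0, ω⟩ (nestedFadingLetters_signs hκ hω hω1 hr) k hr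
    (geometricIncrements_nestedFading F hω.le hω1 hr₀ θ.γ) (windowedNE9_nestedFading F hω.le hr hr₀ θ.γ κ)

/-- The windowed kernels of the family at a history converge to `(1 − r)⁻¹ · [μ = ν = 0][z = 0] · fadingAmp` (`0 ≤ r < 1`). -/
theorem tendsto_polWindow_nestedFading (hr : r < 1) (hr₀ : 0 ≤ r) (k : ℕ) (v : Fin (k + 1) → ℝ) (μ ν : Fin 4) (z : Fin 4 → ℤ) :
    Tendsto (fun K : ℕ => polWindow F K (k + 1) (fun W : Fin (F.P K).d → Site (F.P K) (k + 1) → ℝ =>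
        ∑ i ∈ Finset.range (K + 1), fadingAmp ω k v * r ^ i * W (Fin.cast (F.P_d K).symm 0) (siteOfInt F K (k + 1) 0)) (ContinuousLinearMap.id ℝ ℝ)
        (Module.Basis.singleton Unit ℝ) μ ν z) atTop (𝓝 ((1 - r)⁻¹ * if μ = 0 ∧ ν = 0 ∧ z = 0 then fadingAmp ω k v else 0)) := by
  simp only [polWindow_nestedFading]
  refine (((hasSum_geometric_of_lt_one hr₀ hr).tendsto_sum_nat).comp (tendsto_add_atTop_nat 1)).mul (tendsto_const_nhds.congr' ?_)
  filter_upwards [polWindow_fadingTermFamily_eventually F ω k v μ ν z] with K hK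
  exact hK.symm

/-- **W1-19's LIMITING KERNEL OF THE FAMILY, IN CLOSED FORM**: `kernelA g k μ ν z = [μ = ν = 0][z = 0] · (1 − r)⁻¹ · fadingAmp ω k (g_0, …, g_k)` — non-zero at the origin entry and
reading EVERY coupling of the history (`0 ≤ r < 1`). -/
theorem kernelA_nestedFading (hr : r < 1) (hr₀ : 0 ≤ r) (g : ℕ → ℝ) (k : ℕ) (μ ν : Fin 4) (z : Fin 4 → ℤ) :
    kernelA F (fun k v K (W : Fin (F.P K).d → Site (F.P K) (k + 1) → ℝ) =>
        ∑ i ∈ Finset.range (K + 1), fadingAmp ω k v * r ^ i * W (Fin.cast (F.P_d K).symm 0) (siteOfInt F K (k + 1) 0)) (ContinuousLinearMap.id ℝ ℝ)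
        (Module.Basis.singleton Unit ℝ) g k μ ν z =
      (1 - r)⁻¹ * if μ = 0 ∧ ν = 0 ∧ z = 0 then fadingAmp ω k (histPrefix g k) else 0 :=
  (tendsto_polWindow_nestedFading F hr hr₀ k (histPrefix g k) μ ν z).limUnder_eq

/-- **… AND ATTAINED BY NO WINDOWED KERNEL** at the origin entry (`0 < ω`, `0 < r < 1`, `g` in the window): the finite-volume kernel is `(Σ_{i ≤ K} r^i) · fadingAmp <
(1 − r)⁻¹ · fadingAmp`. -/
theorem polWindow_lt_kernelA_nestedFading (hω : 0 < ω) (hr : r < 1) (hr₀ : 0 < r) {γ : ℝ} {g : ℕ → ℝ} (hg : g ∈ Window γ) (k K : ℕ) :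
    polWindow F K (k + 1) (fun W : Fin (F.P K).d → Site (F.P K) (k + 1) → ℝ =>
        ∑ i ∈ Finset.range (K + 1), fadingAmp ω k (histPrefix g k) * r ^ i * W (Fin.cast (F.P_d K).symm 0) (siteOfInt F K (k + 1) 0))
        (ContinuousLinearMap.id ℝ ℝ) (Module.Basis.singleton Unit ℝ) 0 0 0 <
      kernelA F (fun k v K (W : Fin (F.P K).d → Site (F.P K) (k + 1) → ℝ) =>
        ∑ i ∈ Finset.range (K + 1), fadingAmp ω k v * r ^ i * W (Fin.cast (F.P_d K).symm 0) (siteOfInt F K (k + 1) 0)) (ContinuousLinearMap.id ℝ ℝ)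
        (Module.Basis.singleton Unit ℝ) g k 0 0 0 := by
  rw [kernelA_nestedFading F hr hr₀.le, polWindow_nestedFading, polWindow_fadingTermFamily]
  simp only [true_and, if_true]
  refine mul_lt_mul_of_pos_right ?_ (fadingAmp_pos hω (histPrefix_mem_box hg k))
  rw [geom_sum_eq hr.ne, show (r ^ (K + 1) - 1) / (r - 1) = (1 - r ^ (K + 1)) / (1 - r) by rw [← neg_sub 1 (r ^ (K + 1)), ← neg_sub 1 r, neg_div_neg_eq],
    inv_eq_one_div]
  exact div_lt_div_of_pos_right (sub_lt_self 1 (pow_pos hr₀ _)) (sub_pos.2 hr)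

end Nodes

end YMDAG.N22.AtKernels.NestedTermsModel

end
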